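import Mathlib.Analysis.SpecialFunctions.Complex.Arg
import Mathlib.Analysis.SpecialFunctions.Complex.Analytic
import Mathlib.Analysis.SpecialFunctions.Complex.Log
import Mathlib.Analysis.InnerProductSpace.Harmonic.Constructions
import Literature.Analysis.Complex.HarmonicMaxPrinciple
import HarnessLib

/-!
# Harmonic measure of an arc of the unit circle; Löwner's lemma (majorization of harmonic measure)

Trunk support (complex analysis). For an open arc `A = {e^{it} : α < t < β}` of the unit circle
(`0 < β - α < 2π`) the **harmonic measure** `ω(z, A)` of `A` at `z ∈ 𝔻` (Pommerenke (1992),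
§4.4 (1): the Poisson integral of `1_A`; Ahlfors, *Conformal Invariants* (1973), Ch. 3 §3-1,
Example 3-2) is written here in the closed form

`ω(z, A) = (1/π) arg ( e^{-iδ} (z - e^{iβ}) / (z - e^{iα}) )`, `δ = (β - α)/2`

(`Literature.Analysis.Complex.arcHM`): the Möbius map `S(z) = e^{-iδ}(z - e^{iβ})/(z - e^{iα})`
(`Literature.Analysis.Complex.arcMoebius`) sends `𝔻` onto the upper half-plane, `A` onto the
negative and the complementary arc onto the positive real axis, and `S(0) = e^{iδ}`; so `ω(·, A)`
is harmonic on `𝔻` (`= Im log S / π`), takes values in `[0, 1]`, tends to `1` at the points of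
`A` and to `0` at the points of the complementary open arc, and `ω(0, A) = (β - α)/(2π) =
Λ(A)/(2π)` (Pommerenke (1992), §4.4 (5)). Everything is proved from the explicit formula
`Im (e^{-iδ}(z - e^{iβ}) conj(z - e^{iα})) = sin δ · (1 - |z|²)`.

Main results (all proved):

* `Literature.Analysis.Complex.le_of_harmonicOnNhd_ball_of_boundary_ge_one` — **majorization**
  (Ahlfors (1973), Ch. 3 §3-1, Thm. 3-1, for the disc): a non-negative harmonic function `G` on
  `𝔻` whose boundary values are `≥ 1` at every point of the open arc `A` satisfies
  `G(0) ≥ Λ(A)/(2π)`; proof: the maximum principle in lim-sup form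
  (`Literature.Analysis.Complex.harmonic_le_of_frontier_of_cocompact`) applied to
  `ω(·, A') - G` for compact sub-arcs `A' ⊂ A` (no exceptional boundary points arise).
* `Literature.Analysis.Complex.loewner_lemma` — **Löwner's lemma** (Pommerenke (1992), §4.4,
  Prop. 4.15, for arcs): if `F : 𝔻 → 𝔻` is holomorphic and has, at every point of the arc `A`,
  a boundary value lying in the arc `B = {e^{it} : α' < t < β'}`, then
  `ω(F(0), B) ≥ Λ(A)/(2π)`; for `F(0) = 0` this is `Λ(B) ≥ Λ(A)`. With `F = f₂⁻¹ ∘ f₁` for Riemann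
  maps `f_j : 𝔻 → G_j`, `G₁ ⊆ G₂`, this is Carleman's principle of domain extension for harmonic
  measure (Pommerenke (1992), Cor. 4.16), used in
  `Literature/Probability/RandomPlanarGeometry/RectangleModulusProofs.lean` for the monotonicity
  and continuity of the conformal modulus of a rectangle in its aspect ratio.

## Mathlib

USED: `Complex.arg` and its continuity (`Complex.continuousAt_arg`,
`Complex.continuousWithinAt_arg_of_re_neg_of_im_zero`), `Complex.log_im`, `analyticAt_clog`,
`AnalyticAt.harmonicAt_im` (real/imaginary parts of holomorphic functions are harmonic,
`InnerProductSpace.HarmonicAt`), `toIcoMod`. Mathlib has the Poisson kernel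
(`Mathlib.Analysis.Complex.Harmonic.Poisson`) but no harmonic measure and no Löwner lemma
(searched `harmonic measure`, `Löwner`, `Loewner`, `Lindelöf`).

## References

* Ch. Pommerenke, *Boundary Behaviour of Conformal Maps*, Grundlehren 299, Springer (1992), §4.4,
  (1), (5), Prop. 4.15 (Löwner's lemma), Cor. 4.16 (Carleman's principle).
* L. V. Ahlfors, *Conformal Invariants: Topics in Geometric Function Theory*, McGraw-Hill (1973),
  Ch. 3 §3-1, Thm. 3-1 (majorization principle), Corollary, Examples 3-1, 3-2.
* K. Löwner, *Untersuchungen über schlichte konforme Abbildungen des Einheitskreises*, Math. Ann.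
  89 (1923) 103–121.
-/

noncomputable section

open Set Filter Metric Topology Complex InnerProductSpace
open scoped Real ComplexConjugate

namespace Literature.Analysis.Complex

/-! ### Points of the unit circle as `e^{it}` -/

/-- Every point of the unit circle is `e^{it}` for some `t` in any prescribed half-open window of
length `2π`. [folklore] -/
theorem exists_mem_Ico_exp_mul_I_eq {ζ : ℂ} (hζ : ‖ζ‖ = 1) (s : ℝ) :
    ∃ t ∈ Ico s (s + 2 * π), exp (t * I) = ζ := by
  refine ⟨toIcoMod Real.two_pi_pos s (arg ζ), toIcoMod_mem_Ico _ _ _, ?_⟩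
  have h1 : exp ((toIcoMod Real.two_pi_pos s (arg ζ) : ℝ) * I) = exp ((arg ζ : ℝ) * I) := by
    have h := self_sub_toIcoMod Real.two_pi_pos s (arg ζ)
    have h' : toIcoMod Real.two_pi_pos s (arg ζ) =
        arg ζ - toIcoDiv Real.two_pi_pos s (arg ζ) * (2 * π) := by rw [zsmul_eq_mul] at h; linarith [h]
    rw [h', ofReal_sub, sub_mul, Complex.exp_sub]
    have h2 : exp (((toIcoDiv Real.two_pi_pos s (arg ζ) * (2 * π) : ℝ) : ℂ) * I) = 1 := by
      have := exp_int_mul_two_pi_mul_I (toIcoDiv Real.two_pi_pos s (arg ζ))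
      rw [← this]; congr 1; push_cast; ring
    rw [h2, div_one]
  rw [h1]
  have h2 := norm_mul_exp_arg_mul_I ζ
  rwa [hζ, ofReal_one, one_mul] at h2

/-- `e^{it} ≠ e^{is}` when `0 < t - s < 2π`. [folklore] -/
theorem exp_mul_I_ne_of_lt {s t : ℝ} (h0 : s < t) (h2π : t - s < 2 * π) :
    exp (t * I) ≠ exp (s * I) := by
  intro h
  obtain ⟨n, hn⟩ := exp_eq_exp_iff_exists_int.1 h
  have hn' : ((t : ℂ) - s) * I = n * (2 * π * I) := by linear_combination hn
  have hre : t - s = n * (2 * π) := by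
    have := congrArg Complex.im hn'
    simp at this
    linarith
  have h1 : (0 : ℝ) < n := by
    have : (0 : ℝ) < n * (2 * π) := by rw [← hre]; linarith
    exact pos_of_mul_pos_left this (by positivity)
  have h2 : (n : ℝ) < 1 := by
    have : (n : ℝ) * (2 * π) < 1 * (2 * π) := by rw [← hre, one_mul]; exact h2π
    exact lt_of_mul_lt_mul_right this (by positivity)
  have h1' : (0 : ℤ) < n := by exact_mod_cast h1
  have h2' : n < (1 : ℤ) := by exact_mod_cast h2
  omega

/-- `e^{it}` lies on the unit circle. [folklore] -/
theorem exp_mul_I_mem_sphere (t : ℝ) : exp (t * I) ∈ sphere (0 : ℂ) 1 := by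
  rw [mem_sphere_zero_iff_norm]
  exact norm_exp_ofReal_mul_I t

/-- `e^{it}` is not in the open unit disc. [folklore] -/
theorem exp_mul_I_not_mem_ball (t : ℝ) : exp (t * I) ∉ ball (0 : ℂ) 1 := by
  rw [mem_ball_zero_iff, norm_exp_ofReal_mul_I]
  exact lt_irrefl 1

/-! ### The Möbius map of the arc and the harmonic measure -/

/-- The Möbius map `S_{α,β}(z) = e^{-iδ} (z - e^{iβ})/(z - e^{iα})`, `δ = (β - α)/2`, which sends
`𝔻` onto the upper half-plane, the arc `{e^{it} : α < t < β}` onto the negative real axis and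
`0` to `e^{iδ}` (Ahlfors (1973), Ch. 3 §3-1, Examples 3-1, 3-2). Junk value at the pole
`z = e^{iα}` (division by zero). [cite: Ahlfors1973CI, Ch. 3 §3-1 Example 3-2] -/
def arcMoebius (α β : ℝ) (z : ℂ) : ℂ :=
  exp (-(((β - α) / 2 : ℝ) : ℂ) * I) * (z - exp (β * I)) / (z - exp (α * I))

/-- **Harmonic measure of the arc `{e^{it} : α < t < β}` of the unit circle at `z ∈ 𝔻`**, in the
closed form `ω(z) = arg S_{α,β}(z) / π` (`S` = `arcMoebius`); it is the Poisson integral of the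
indicator of the arc (Pommerenke (1992), §4.4 (1); Ahlfors (1973), Ch. 3 §3-1, Example 3-2:
"`ω(z) = (2θ - α)/2π` where `θ` is the angle subtended by the arc at `z`"). Meaningful for
`0 < β - α < 2π` and `‖z‖ < 1`. [cite: PommerenkeBBCM1992, §4.4 (1)] -/
def arcHM (α β : ℝ) (z : ℂ) : ℝ :=
  arg (arcMoebius α β z) / π

/-- The numerator `P(z) = e^{-iδ} (z - e^{iβ}) conj(z - e^{iα})` of `S_{α,β}(z) = P(z)/|z - e^{iα}|²`.
[folklore] -/
def arcNum (α β : ℝ) (z : ℂ) : ℂ :=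
  exp (-(((β - α) / 2 : ℝ) : ℂ) * I) * (z - exp (β * I)) * conj (z - exp (α * I))

/-- `conj (e^{it}) = e^{-it}`. [folklore] -/
theorem conj_exp_mul_I (t : ℝ) : conj (exp (t * I)) = exp (-(t : ℂ) * I) := by
  rw [← exp_conj, map_mul, conj_ofReal, conj_I, mul_neg, neg_mul]

/-- The closed form of the numerator: with `δ = (β-α)/2`, `μ = (α+β)/2`,
`P(z) = e^{-iδ} |z|² + e^{iδ} - (z e^{-iμ} + conj (z e^{-iμ}))`. [folklore] -/
theorem arcNum_eq (α β : ℝ) (z : ℂ) :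
    arcNum α β z = exp (-(((β - α) / 2 : ℝ) : ℂ) * I) * (normSq z : ℂ) +
      exp ((((β - α) / 2 : ℝ) : ℂ) * I) -
      (z * exp (-(((α + β) / 2 : ℝ) : ℂ) * I) + conj (z * exp (-(((α + β) / 2 : ℝ) : ℂ) * I))) := by
  have hw : conj (z * exp (-(((α + β) / 2 : ℝ) : ℂ) * I)) = conj z * exp ((((α + β) / 2 : ℝ) : ℂ) * I) := by
    rw [map_mul, ← exp_conj, map_mul, map_neg, conj_ofReal, conj_I, mul_neg, neg_mul, neg_neg]
  rw [hw]
  unfold arcNum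
  rw [map_sub, conj_exp_mul_I, ← mul_conj]
  have hβ : exp ((β : ℂ) * I) = exp ((((α + β) / 2 : ℝ) : ℂ) * I) * exp ((((β - α) / 2 : ℝ) : ℂ) * I) := by
    rw [← Complex.exp_add]; congr 1; push_cast; ring
  have hα : exp (-(α : ℂ) * I) = exp (-(((α + β) / 2 : ℝ) : ℂ) * I) * exp ((((β - α) / 2 : ℝ) : ℂ) * I) := by
    rw [← Complex.exp_add]; congr 1; push_cast; ring
  have h1 : exp (-(((β - α) / 2 : ℝ) : ℂ) * I) * exp ((((β - α) / 2 : ℝ) : ℂ) * I) = 1 := by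
    rw [← Complex.exp_add]; convert Complex.exp_zero using 2; ring
  have h2 : exp (-(((α + β) / 2 : ℝ) : ℂ) * I) * exp ((((α + β) / 2 : ℝ) : ℂ) * I) = 1 := by
    rw [← Complex.exp_add]; convert Complex.exp_zero using 2; ring
  rw [hβ, hα]
  linear_combination (-(z * exp (-(((α + β) / 2 : ℝ) : ℂ) * I) + conj z * exp ((((α + β) / 2 : ℝ) : ℂ) * I)) +
    exp ((((β - α) / 2 : ℝ) : ℂ) * I) * exp ((((α + β) / 2 : ℝ) : ℂ) * I) *
      exp (-(((α + β) / 2 : ℝ) : ℂ) * I)) * h1 + exp ((((β - α) / 2 : ℝ) : ℂ) * I) * h2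

/-- `Im P(z) = sin δ · (1 - |z|²)`. [folklore] -/
theorem arcNum_im (α β : ℝ) (z : ℂ) :
    (arcNum α β z).im = Real.sin ((β - α) / 2) * (1 - normSq z) := by
  rw [arcNum_eq]
  have h3 : (z * exp (-(((α + β) / 2 : ℝ) : ℂ) * I) + conj (z * exp (-(((α + β) / 2 : ℝ) : ℂ) * I))).im = 0 := by
    rw [add_conj]; exact ofReal_im _
  simp only [sub_im, add_im, h3, sub_zero, mul_im, ofReal_re, ofReal_im, mul_zero]
  have e1 : (exp (-(((β - α) / 2 : ℝ) : ℂ) * I)).im = -Real.sin ((β - α) / 2) := by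
    rw [show -(((β - α) / 2 : ℝ) : ℂ) * I = ((-((β - α) / 2) : ℝ) : ℂ) * I by push_cast; ring,
      exp_ofReal_mul_I_im, Real.sin_neg]
  rw [e1, exp_ofReal_mul_I_im]
  ring

/-- `Re P(z) = cos δ · (1 + |z|²) - 2 Re (z e^{-iμ})`. [folklore] -/
theorem arcNum_re (α β : ℝ) (z : ℂ) :
    (arcNum α β z).re = Real.cos ((β - α) / 2) * (1 + normSq z) -
      2 * (z * exp (-(((α + β) / 2 : ℝ) : ℂ) * I)).re := by
  rw [arcNum_eq]
  have h3 : (z * exp (-(((α + β) / 2 : ℝ) : ℂ) * I) + conj (z * exp (-(((α + β) / 2 : ℝ) : ℂ) * I))).re =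
      2 * (z * exp (-(((α + β) / 2 : ℝ) : ℂ) * I)).re := by
    rw [add_conj, ofReal_re]
  simp only [sub_re, add_re, h3, mul_re, ofReal_re, ofReal_im, mul_zero, sub_zero]
  have e1 : (exp (-(((β - α) / 2 : ℝ) : ℂ) * I)).re = Real.cos ((β - α) / 2) := by
    rw [show -(((β - α) / 2 : ℝ) : ℂ) * I = ((-((β - α) / 2) : ℝ) : ℂ) * I by push_cast; ring,
      exp_ofReal_mul_I_re, Real.cos_neg]
  rw [e1, exp_ofReal_mul_I_re]
  ring

/-- On the unit circle, `Re P(e^{it}) = 2 (cos δ - cos (t - μ))`. [folklore] -/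
theorem arcNum_exp_re (α β t : ℝ) :
    (arcNum α β (exp (t * I))).re = 2 * (Real.cos ((β - α) / 2) - Real.cos (t - (α + β) / 2)) := by
  rw [arcNum_re, normSq_eq_norm_sq, norm_exp_ofReal_mul_I, ← Complex.exp_add,
    show (t : ℂ) * I + -(((α + β) / 2 : ℝ) : ℂ) * I = ((t - (α + β) / 2 : ℝ) : ℂ) * I by push_cast; ring,
    exp_ofReal_mul_I_re]
  ring

/-- On the unit circle, `Im P(e^{it}) = 0`. [folklore] -/
theorem arcNum_exp_im (α β t : ℝ) : (arcNum α β (exp (t * I))).im = 0 := by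
  rw [arcNum_im, normSq_eq_norm_sq, norm_exp_ofReal_mul_I]
  ring

/-- `S(z) = P(z) · |z - e^{iα}|⁻²` away from the pole. [folklore] -/
theorem arcMoebius_eq (α β : ℝ) {z : ℂ} (hz : z ≠ exp (α * I)) :
    arcMoebius α β z = arcNum α β z * ((normSq (z - exp (α * I)))⁻¹ : ℝ) := by
  have hne : z - exp (α * I) ≠ 0 := sub_ne_zero.2 hz
  unfold arcMoebius arcNum
  rw [div_eq_mul_inv, inv_def, ofReal_inv]
  ring

/-- `arg S(z) = arg P(z)` away from the pole. [folklore] -/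
theorem arg_arcMoebius (α β : ℝ) {z : ℂ} (hz : z ≠ exp (α * I)) :
    arg (arcMoebius α β z) = arg (arcNum α β z) := by
  rw [arcMoebius_eq α β hz]
  exact arg_mul_real (inv_pos.2 (normSq_pos.2 (sub_ne_zero.2 hz))) _

/-- `Im S(z) = Im P(z) / |z - e^{iα}|²` away from the pole. [folklore] -/
theorem arcMoebius_im (α β : ℝ) {z : ℂ} (hz : z ≠ exp (α * I)) :
    (arcMoebius α β z).im = (arcNum α β z).im * (normSq (z - exp (α * I)))⁻¹ := by
  rw [arcMoebius_eq α β hz, mul_im, ofReal_re, ofReal_im, mul_zero, zero_add]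

/-- `Re S(z) = Re P(z) / |z - e^{iα}|²` away from the pole. [folklore] -/
theorem arcMoebius_re (α β : ℝ) {z : ℂ} (hz : z ≠ exp (α * I)) :
    (arcMoebius α β z).re = (arcNum α β z).re * (normSq (z - exp (α * I)))⁻¹ := by
  rw [arcMoebius_eq α β hz, mul_re, ofReal_re, ofReal_im, mul_zero, sub_zero]

/-- A point of the open disc is not the pole `e^{iα}`. [folklore] -/
theorem ne_exp_of_mem_ball {z : ℂ} (hz : z ∈ ball (0 : ℂ) 1) (α : ℝ) : z ≠ exp (α * I) := by
  rintro rfl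
  exact exp_mul_I_not_mem_ball α hz

/-- `S` maps the disc into the upper half-plane: `Im S(z) > 0` for `‖z‖ < 1` (`0 < β - α < 2π`).
[folklore] -/
theorem arcMoebius_im_pos {α β : ℝ} (hαβ : α < β) (h2π : β - α < 2 * π) {z : ℂ}
    (hz : z ∈ ball (0 : ℂ) 1) : 0 < (arcMoebius α β z).im := by
  have hz1 : normSq z < 1 := by
    rw [normSq_eq_norm_sq]
    have := mem_ball_zero_iff.1 hz
    nlinarith [norm_nonneg z]
  rw [arcMoebius_im α β (ne_exp_of_mem_ball hz α), arcNum_im]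
  refine mul_pos (mul_pos ?_ (by linarith)) (inv_pos.2 (normSq_pos.2 (sub_ne_zero.2 (ne_exp_of_mem_ball hz α))))
  exact Real.sin_pos_of_pos_of_lt_pi (by linarith) (by linarith)

/-- The harmonic measure is non-negative on the disc. [folklore] -/
theorem arcHM_nonneg {α β : ℝ} (hαβ : α < β) (h2π : β - α < 2 * π) {z : ℂ} (hz : z ∈ ball (0 : ℂ) 1) :
    0 ≤ arcHM α β z :=
  div_nonneg (arg_nonneg_iff.2 (arcMoebius_im_pos hαβ h2π hz).le) Real.pi_pos.le

/-- The harmonic measure is at most `1`. [folklore] -/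
theorem arcHM_le_one (α β : ℝ) (z : ℂ) : arcHM α β z ≤ 1 :=
  (div_le_one Real.pi_pos).2 (arg_le_pi _)

/-- **`ω(0, A) = Λ(A)/(2π)`** (Pommerenke (1992), §4.4 (5)): `S(0) = e^{iδ}`.
[cite: PommerenkeBBCM1992, §4.4 (5)] -/
theorem arcHM_zero {α β : ℝ} (hαβ : α < β) (h2π : β - α ≤ 2 * π) :
    arcHM α β 0 = (β - α) / (2 * π) := by
  have hS : arcMoebius α β 0 = exp ((((β - α) / 2 : ℝ) : ℂ) * I) := by
    unfold arcMoebius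
    rw [zero_sub, zero_sub, mul_neg, neg_div_neg_eq, mul_div_assoc, ← Complex.exp_sub, ← Complex.exp_add]
    congr 1; push_cast; ring
  rw [arcHM, hS, arg_exp_mul_I, toIocMod_eq_self Real.two_pi_pos |>.2 ⟨by linarith, by linarith⟩]
  field_simp

/-- `S` is analytic away from its pole. [folklore] -/
theorem analyticAt_arcMoebius (α β : ℝ) {z : ℂ} (hz : z ≠ exp (α * I)) :
    AnalyticAt ℂ (arcMoebius α β) z := by
  unfold arcMoebius
  exact ((analyticAt_const.mul (analyticAt_id.sub analyticAt_const)).div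
    (analyticAt_id.sub analyticAt_const) (sub_ne_zero.2 hz))

/-- **The harmonic measure composed with a holomorphic map into the disc is harmonic**: if `H` is
analytic at `z` with values in `𝔻` near `z`, then `w ↦ ω(H w, A)` is harmonic at `z`
(`ω ∘ H = Im log (S ∘ H) / π`). In particular (`H = id`) `ω(·, A)` is harmonic on `𝔻`. [folklore] -/
theorem harmonicAt_arcHM_comp {α β : ℝ} (hαβ : α < β) (h2π : β - α < 2 * π) {H : ℂ → ℂ} {z : ℂ}
    (hH : AnalyticAt ℂ H z) (hHz : H z ∈ ball (0 : ℂ) 1) :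
    HarmonicAt (fun w ↦ arcHM α β (H w)) z := by
  have h1 : AnalyticAt ℂ (fun w ↦ log (arcMoebius α β (H w))) z := by
    refine (analyticAt_clog ?_).comp ((analyticAt_arcMoebius α β (ne_exp_of_mem_ball hHz α)).comp hH)
    exact Or.inr (arcMoebius_im_pos hαβ h2π hHz).ne'
  have h2 : HarmonicAt (fun w ↦ (log (arcMoebius α β (H w))).im) z := h1.harmonicAt_im
  have h3 := h2.const_smul (c := π⁻¹)
  convert h3 using 1
  funext w
  simp only [Pi.smul_apply, smul_eq_mul, arcHM, log_im]
  ring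

/-- The harmonic measure of an arc is harmonic on the disc. [cite: PommerenkeBBCM1992, §4.4 (1)] -/
theorem harmonicOnNhd_arcHM {α β : ℝ} (hαβ : α < β) (h2π : β - α < 2 * π) :
    HarmonicOnNhd (arcHM α β) (ball (0 : ℂ) 1) := fun _ hz ↦
  harmonicAt_arcHM_comp hαβ h2π analyticAt_id hz

/-- The harmonic measure is continuous at interior points. [folklore] -/
theorem continuousAt_arcHM {α β : ℝ} (hαβ : α < β) (h2π : β - α < 2 * π) {z : ℂ}
    (hz : z ∈ ball (0 : ℂ) 1) : ContinuousAt (arcHM α β) z := by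
  have h1 : ContinuousAt (arcMoebius α β) z :=
    (analyticAt_arcMoebius α β (ne_exp_of_mem_ball hz α)).continuousAt
  have h2 : ContinuousAt arg (arcMoebius α β z) :=
    continuousAt_arg (Or.inr (arcMoebius_im_pos hαβ h2π hz).ne')
  exact (h2.comp h1).div_const π

/-- `S` maps a neighbourhood of a non-pole point within the disc into the closed upper half-plane,
tending to `S(ζ)`. [folklore] -/
theorem tendsto_arcMoebius_nhdsWithin {α β : ℝ} (hαβ : α < β) (h2π : β - α < 2 * π) {ζ : ℂ}
    (hζ : ζ ≠ exp (α * I)) :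
    Tendsto (arcMoebius α β) (𝓝[ball (0 : ℂ) 1] ζ) (𝓝[{w : ℂ | 0 ≤ w.im}] (arcMoebius α β ζ)) :=
  ((analyticAt_arcMoebius α β hζ).continuousAt.continuousWithinAt).tendsto_nhdsWithin
    fun _ hz ↦ (arcMoebius_im_pos hαβ h2π hz).le

/-- **Boundary value `1` on the arc**: `ω(z, A) → 1` as `z → e^{it}` inside the disc, for
`α < t < β` (there `S(e^{it})` is a negative real number). [cite: PommerenkeBBCM1992, §4.4 (2)] -/
theorem tendsto_arcHM_one {α β : ℝ} (h2π : β - α < 2 * π) {t : ℝ} (ht : t ∈ Ioo α β) :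
    Tendsto (arcHM α β) (𝓝[ball (0 : ℂ) 1] (exp (t * I))) (𝓝 1) := by
  have hαβ : α < β := ht.1.trans ht.2
  have hζ : exp (t * I) ≠ exp (α * I) := exp_mul_I_ne_of_lt ht.1 (by linarith [ht.2])
  have hre : (arcMoebius α β (exp (t * I))).re < 0 := by
    rw [arcMoebius_re α β hζ, arcNum_exp_re]
    refine mul_neg_of_neg_of_pos ?_ (inv_pos.2 (normSq_pos.2 (sub_ne_zero.2 hζ)))
    have hcos : Real.cos ((β - α) / 2) < Real.cos (t - (α + β) / 2) := by
      rw [← Real.cos_abs (t - (α + β) / 2)]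
      exact Real.cos_lt_cos_of_nonneg_of_le_pi (abs_nonneg _) (by linarith)
        (abs_lt.2 ⟨by linarith [ht.1], by linarith [ht.2]⟩)
    linarith
  have him : (arcMoebius α β (exp (t * I))).im = 0 := by
    rw [arcMoebius_im α β hζ, arcNum_exp_im, zero_mul]
  have harg : arg (arcMoebius α β (exp (t * I))) = π := arg_eq_pi_iff.2 ⟨hre, him⟩
  have h1 : Tendsto arg (𝓝[{w : ℂ | 0 ≤ w.im}] (arcMoebius α β (exp (t * I)))) (𝓝 π) := by
    have := (continuousWithinAt_arg_of_re_neg_of_im_zero hre him).tendsto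
    rwa [harg] at this
  have h2 := (h1.comp (tendsto_arcMoebius_nhdsWithin hαβ h2π hζ)).div_const π
  rw [div_self Real.pi_pos.ne'] at h2
  exact h2

/-- **Boundary value `0` off the arc**: `ω(z, A) → 0` as `z → e^{it}` inside the disc, for
`β < t < α + 2π` (there `S(e^{it})` is a positive real number). [cite: PommerenkeBBCM1992, §4.4 (2)] -/
theorem tendsto_arcHM_zero {α β : ℝ} (hαβ : α < β) {t : ℝ} (ht : t ∈ Ioo β (α + 2 * π)) :
    Tendsto (arcHM α β) (𝓝[ball (0 : ℂ) 1] (exp (t * I))) (𝓝 0) := by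
  have h2π : β - α < 2 * π := by linarith [ht.1, ht.2]
  have hζ : exp (t * I) ≠ exp (α * I) := exp_mul_I_ne_of_lt (by linarith [ht.1]) (by linarith [ht.2])
  have hre : 0 < (arcMoebius α β (exp (t * I))).re := by
    rw [arcMoebius_re α β hζ, arcNum_exp_re]
    refine mul_pos ?_ (inv_pos.2 (normSq_pos.2 (sub_ne_zero.2 hζ)))
    have hcos : Real.cos (t - (α + β) / 2) < Real.cos ((β - α) / 2) := by
      rcases le_or_gt (t - (α + β) / 2) π with h | h
      · exact Real.cos_lt_cos_of_nonneg_of_le_pi (by linarith) h (by linarith [ht.1])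
      · rw [← Real.cos_two_pi_sub]
        exact Real.cos_lt_cos_of_nonneg_of_le_pi (by linarith) (by linarith) (by linarith [ht.2])
    linarith
  have him : (arcMoebius α β (exp (t * I))).im = 0 := by
    rw [arcMoebius_im α β hζ, arcNum_exp_im, zero_mul]
  have harg : arg (arcMoebius α β (exp (t * I))) = 0 := arg_eq_zero_iff.2 ⟨hre.le, him⟩
  have h1 : Tendsto arg (𝓝 (arcMoebius α β (exp (t * I)))) (𝓝 0) := by
    have := (continuousAt_arg (Or.inl hre)).tendsto
    rwa [harg] at this
  have h0 : Tendsto (arcMoebius α β) (𝓝[ball (0 : ℂ) 1] (exp (t * I))) (𝓝 (arcMoebius α β (exp (t * I)))) :=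
    ((analyticAt_arcMoebius α β hζ).continuousAt.continuousWithinAt (s := ball (0 : ℂ) 1)).tendsto
  have h2 := (h1.comp h0).div_const π
  rw [zero_div] at h2
  exact h2

/-! ### Majorization and Löwner's lemma -/

/-- **Majorization by harmonic measure** (Ahlfors (1973), Ch. 3 §3-1, Thm. 3-1 and Example 3-2,
for the disc; the step `u ≥ ω(·, A)` in Pommerenke's proof of Prop. 4.15): a non-negative
harmonic function `G` on `𝔻` with `lim inf G ≥ 1` at every point `e^{it}`, `α < t < β`, of an
open arc of length `β - α ≤ 2π` satisfies `G(0) ≥ (β - α)/(2π)`. Proof: for compact sub-arcs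
`[α', β'] ⊂ (α, β)`, `ω(·, (α', β')) - G` has `lim sup ≤ 0` at EVERY boundary point, so the
maximum principle (`harmonic_le_of_frontier_of_cocompact`) gives `ω(0, (α',β')) ≤ G 0`.
[cite: Ahlfors1973CI, Ch. 3 §3-1 Thm. 3-1] -/
theorem le_of_harmonicOnNhd_ball_of_boundary_ge_one {G : ℂ → ℝ} {α β : ℝ} (hαβ : α < β)
    (h2π : β - α ≤ 2 * π) (hG : HarmonicOnNhd G (ball (0 : ℂ) 1))
    (hG0 : ∀ z ∈ ball (0 : ℂ) 1, 0 ≤ G z)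
    (hG1 : ∀ t ∈ Ioo α β, ∀ ε : ℝ, 0 < ε → ∀ᶠ z in 𝓝[ball (0 : ℂ) 1] (exp (t * I)), 1 - ε ≤ G z) :
    (β - α) / (2 * π) ≤ G 0 := by
  -- shrunken arcs
  have key : ∀ ε' : ℝ, 0 < ε' → 2 * ε' < β - α → (β - α - 2 * ε') / (2 * π) ≤ G 0 := by
    intro ε' hε' hε'2
    set α' : ℝ := α + ε' with hα'
    set β' : ℝ := β - ε' with hβ'
    have hα'β' : α' < β' := by rw [hα', hβ']; linarith
    have h2π' : β' - α' < 2 * π := by rw [hα', hβ']; linarith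
    have hharm : HarmonicOnNhd (fun z ↦ arcHM α' β' z - G z) (ball (0 : ℂ) 1) :=
      (harmonicOnNhd_arcHM hα'β' h2π').sub hG
    have hbdry : ∀ ζ ∈ frontier (ball (0 : ℂ) 1), ∀ ε : ℝ, 0 < ε →
        ∀ᶠ z in 𝓝[ball (0 : ℂ) 1] ζ, arcHM α' β' z - G z ≤ 0 + ε := by
      intro ζ hζ ε hε
      rw [frontier_ball _ one_ne_zero, mem_sphere_zero_iff_norm] at hζ
      obtain ⟨t, ht, rfl⟩ := exists_mem_Ico_exp_mul_I_eq hζ α'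
      by_cases htβ : t < β
      · have h1 := hG1 t ⟨by rw [hα'] at ht; linarith [ht.1], htβ⟩ ε hε
        filter_upwards [h1] with z hz
        linarith [arcHM_le_one α' β' z]
      · push Not at htβ
        have h0 := tendsto_arcHM_zero hα'β' (t := t) ⟨by rw [hβ']; linarith, ht.2⟩
        filter_upwards [h0.eventually_lt_const hε, self_mem_nhdsWithin] with z hz hzb
        linarith [hG0 z hzb]
    have hinf : ∀ ε : ℝ, 0 < ε → ∀ᶠ z in cocompact ℂ ⊓ 𝓟 (ball (0 : ℂ) 1),
        arcHM α' β' z - G z ≤ 0 + ε := by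
      intro ε hε
      rw [Filter.eventually_inf_principal]
      filter_upwards [(isCompact_closedBall (0 : ℂ) 1).compl_mem_cocompact] with z hz hzb
      exact absurd (ball_subset_closedBall hzb) hz
    have hle := harmonic_le_of_frontier_of_cocompact isOpen_ball (convex_ball _ _).isPreconnected
      hharm hbdry hinf 0 (mem_ball_self one_pos)
    have h0 : arcHM α' β' 0 = (β' - α') / (2 * π) := arcHM_zero hα'β' h2π'.le
    have h0' : (β' - α') / (2 * π) = (β - α - 2 * ε') / (2 * π) := by rw [hα', hβ']; ring
    have hle' : arcHM α' β' 0 - G 0 ≤ 0 := hle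
    rw [h0, h0'] at hle'
    linarith
  refine le_of_forall_pos_le_add fun ε hε ↦ ?_
  set ε' : ℝ := min (π * ε) ((β - α) / 4) with hε'
  have hε'0 : 0 < ε' := lt_min (by positivity) (by linarith)
  have hε'1 : ε' ≤ π * ε := min_le_left _ _
  have hε'2 : 2 * ε' < β - α := by
    have := min_le_right (π * ε) ((β - α) / 4); rw [← hε'] at this; linarith
  have h := key ε' hε'0 hε'2
  have hsplit : (β - α) / (2 * π) = (β - α - 2 * ε') / (2 * π) + ε' / π := by
    field_simp; ring
  rw [hsplit]
  have : ε' / π ≤ ε := by rw [div_le_iff₀ Real.pi_pos]; linarith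
  linarith

/-- **Löwner's lemma** (Pommerenke (1992), §4.4, Prop. 4.15, for arcs): let `F : 𝔻 → 𝔻` be
holomorphic and suppose that at every point `e^{it}`, `α < t < β`, of an open arc `A`
(`β - α ≤ 2π`) `F` has a boundary value `e^{it'}` with `α' < t' < β'` (a point of the open arc
`B`, `0 < β' - α' < 2π`). Then `ω(F(0), B) ≥ Λ(A)/(2π)`; when `F(0) = 0` this reads
`Λ(B) ≥ Λ(A)` (`arcHM_zero`). Proof: majorization applied to the harmonic function
`ω(F(·), B)`, which tends to `1` at the points of `A`. [cite: PommerenkeBBCM1992, §4.4 Prop. 4.15] -/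
theorem loewner_lemma {F : ℂ → ℂ} (hF : DifferentiableOn ℂ F (ball (0 : ℂ) 1))
    (hmaps : MapsTo F (ball (0 : ℂ) 1) (ball 0 1)) {α β α' β' : ℝ} (hαβ : α < β)
    (h2π : β - α ≤ 2 * π) (hα'β' : α' < β') (h2π' : β' - α' < 2 * π)
    (hbd : ∀ t ∈ Ioo α β, ∃ t' ∈ Ioo α' β',
      Tendsto F (𝓝[ball (0 : ℂ) 1] (exp (t * I))) (𝓝 (exp (t' * I)))) :
    (β - α) / (2 * π) ≤ arcHM α' β' (F 0) := by
  refine le_of_harmonicOnNhd_ball_of_boundary_ge_one (G := fun z ↦ arcHM α' β' (F z)) hαβ h2π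
    ?_ (fun z hz ↦ arcHM_nonneg hα'β' h2π' (hmaps hz)) ?_
  · intro z hz
    exact harmonicAt_arcHM_comp hα'β' h2π' (hF.analyticAt (isOpen_ball.mem_nhds hz)) (hmaps hz)
  · intro t ht ε hε
    obtain ⟨t', ht', hT⟩ := hbd t ht
    have hT' : Tendsto F (𝓝[ball (0 : ℂ) 1] (exp (t * I))) (𝓝[ball (0 : ℂ) 1] (exp (t' * I))) :=
      tendsto_nhdsWithin_iff.2 ⟨hT, eventually_mem_nhdsWithin.mono fun z hz ↦ hmaps hz⟩
    have h1 := (tendsto_arcHM_one h2π' ht').comp hT'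
    exact h1.eventually_const_le (by linarith)

end Literature.Analysis.Complex
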